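import Summits.MatrixMultiplication.OmegaCensus.SmallFormats.InvertiblePointDeltaLawTwo
import Summits.MatrixMultiplication.OmegaCensus.SmallFormats.MatMul22nGF3MarginalCensus
import HarnessLib

/-!
# ω-census family (a): the δ-law, second form — census consequences (`⟨2,2,5⟩@17`, `⟨2,2,8⟩@27`, the no-IP universe at `(5,17)`)

Cell `pub-omega` (unit `pub-omega-tensor`, gen 34), topic `Summits/MatrixMultiplication/OmegaCensus` (sub-folder
`SmallFormats`). Framing (verbatim): lottery ticket; floor = certified bounds/negative ranges. HONEST FRAMING: corollaries of
`InvertiblePointDeltaLawTwo` (`10n + 2 ≤ 3r ∨ 7n ≤ 2r` at a saturated invertible point, any field):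
* `ten_mul_add_two_le_of_saturated` — any invertible `X₀`, `n ≥ 4`: a saturated `X₀` forces `10n + 2 ≤ 3r`;
* `two_mul_add_one_le_card_filter_ne'` — if `3r ≤ 10n + 1` (`n ≥ 4`) NO invertible point is saturated: at least `2n + 1` X-forms
  are nonzero there;
* `eleven_le_card_filter_ne_225` — **`⟨2,2,5⟩` with 17 terms, any field: at every invertible `X₀` at least 11 of the 17 X-forms are
  nonzero** (at most 6 vanish; the cap alone allows 7). Over `𝔽₃` this is exactly the IP half of the `(5,17)` X-marginal census
  (60 481 of 62 018 orbits, Pa39: δ-engine + LC+1, ENGINE ×1), now ONE kernel theorem without enumeration;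
* `seventeen_le_card_filter_ne_228` — `⟨2,2,8⟩` with 27 terms: no saturated invertible point;
* `eighteen_le_tensorRank_225_gf3_of_noIP_enumeration` — the `(5,17)` census reduction (`MatMul225GF3MarginalCaps`) with the
  universe cut to NO-IP marginals: the engine-side inputs of 'R_𝔽₃(⟨2,2,5⟩) = 18' shrink to the 1 537 no-IP orbits (their
  enumeration ×2 and their exclusions — near-stage / gauge-SAT programme — remain engine-side and OPEN).
Nothing here is the statement 'R_𝔽₃(⟨2,2,5⟩) = 18' and nothing is a bound on `ω`.
-/

namespace Summit.MatrixMultiplication.OmegaCensus.SmallFormats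

open Module Matrix Literature.Computability.AlgebraicComplexity
open Summit.MatrixMultiplication.OmegaCensus.RankOnePlaneCapGeneral

namespace DeltaLaw

variable {k : Type*} [Field k] {n : ℕ} {ι : Type*} [Fintype ι] [DecidableEq ι]

/-- **The δ-LAW, second form, `n ≥ 4`:** a saturated `X₀ = 1` forces `10n + 2 ≤ 3r`. -/
theorem ten_mul_add_two_le_of_saturated_one (hn : 4 ≤ n) (β : BilinComp (mulBilin k 2 2 n) ι) (O : Finset ι)
    (hO : ∀ i, i ∉ O → β.f i 1 = 0) (hO' : ∀ i ∈ O, β.f i 1 ≠ 0) (hcard : O.card = 2 * n) :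
    10 * n + 2 ≤ 3 * Fintype.card ι := by
  rcases ten_mul_add_two_le_or_of_saturated_one β O hO hO' hcard with h | h <;> omega

section Census

variable [DecidableEq k]

/-- **The δ-LAW, second form, at any invertible point** (`n ≥ 4`): a saturated invertible `X₀` (exactly `2n` X-forms nonzero)
of an `r`-term computation of `⟨2,2,n⟩` forces `10n + 2 ≤ 3r`. -/
theorem ten_mul_add_two_le_of_saturated (hn : 4 ≤ n) (β : BilinComp (mulBilin k 2 2 n) ι)
    (X₀ : Matrix (Fin 2) (Fin 2) k) (hX₀ : IsUnit X₀.det)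
    (hsat : (Finset.univ.filter fun i => β.f i X₀ ≠ 0).card = 2 * n) : 10 * n + 2 ≤ 3 * Fintype.card ι := by
  classical
  obtain ⟨β', hf, -, -⟩ := exists_XsideTransform β X₀ X₀⁻¹ 1 1 (Matrix.mul_nonsing_inv X₀ hX₀) (Matrix.one_mul 1)
  have hf1 : ∀ i, β'.f i 1 = β.f i X₀ := fun i => by rw [hf, Matrix.mul_one, Matrix.mul_one]
  refine ten_mul_add_two_le_of_saturated_one hn β' (Finset.univ.filter fun i => β.f i X₀ ≠ 0) ?_ ?_
    (by convert hsat)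
  · intro i hi
    rw [hf1]
    by_contra h
    exact hi (Finset.mem_filter.mpr ⟨Finset.mem_univ i, h⟩)
  · intro i hi
    rw [hf1]
    exact (Finset.mem_filter.mp hi).2

/-- **Census form, second law** (`n ≥ 4`, `3r ≤ 10n + 1`): at every invertible `X₀` at least `2n + 1` X-forms are nonzero —
no saturated invertible point. -/
theorem two_mul_add_one_le_card_filter_ne' (hn : 4 ≤ n) (β : BilinComp (mulBilin k 2 2 n) ι)
    (h3 : 3 * Fintype.card ι ≤ 10 * n + 1) (X₀ : Matrix (Fin 2) (Fin 2) k) (hX₀ : IsUnit X₀.det) :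
    2 * n + 1 ≤ (Finset.univ.filter fun i => β.f i X₀ ≠ 0).card := by
  have h1 : 2 * n ≤ (Finset.univ.filter fun i => β.f i X₀ ≠ 0).card := by
    convert two_mul_le_card_filter_ne β X₀ hX₀
  rcases Nat.lt_or_ge (2 * n) (Finset.univ.filter fun i => β.f i X₀ ≠ 0).card with h | h
  · exact h
  · have heq : (Finset.univ.filter fun i => β.f i X₀ ≠ 0).card = 2 * n := le_antisymm h h1
    have := ten_mul_add_two_le_of_saturated hn β X₀ hX₀ heq
    omega

/-- **`⟨2,2,5⟩` with 17 terms (any field): no saturated invertible point** — at every invertible `X₀` at least 11 of the 17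
X-forms are nonzero (at most 6 vanish). Over `𝔽₃`: the 60 481 IP-orbits of the `(5,17)` X-marginal census are excluded by this
one theorem. -/
theorem eleven_le_card_filter_ne_225 (β : BilinComp (mulBilin k 2 2 5) ι) (hι : Fintype.card ι = 17)
    (X₀ : Matrix (Fin 2) (Fin 2) k) (hX₀ : IsUnit X₀.det) :
    11 ≤ (Finset.univ.filter fun i => β.f i X₀ ≠ 0).card :=
  two_mul_add_one_le_card_filter_ne' (by norm_num) β (by rw [hι]) X₀ hX₀

/-- **`⟨2,2,8⟩` with 27 terms (any field): no saturated invertible point** (at least 17 of the 27 X-forms are nonzero at any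
invertible `X₀`). -/
theorem seventeen_le_card_filter_ne_228 (β : BilinComp (mulBilin k 2 2 8) ι) (hι : Fintype.card ι = 27)
    (X₀ : Matrix (Fin 2) (Fin 2) k) (hX₀ : IsUnit X₀.det) :
    17 ≤ (Finset.univ.filter fun i => β.f i X₀ ≠ 0).card :=
  two_mul_add_one_le_card_filter_ne' (by norm_num) β (by rw [hι]) X₀ hX₀

end Census

end DeltaLaw

end Summit.MatrixMultiplication.OmegaCensus.SmallFormats

namespace Summit.MatrixMultiplication.OmegaCensus.RankOnePlaneCapGeneral

open Module Matrix Literature.Computability.AlgebraicComplexity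
open Summit.MatrixMultiplication.OmegaCensus.SmallFormats

/-- **The δ-law (second form) as a cap on the X-marginal at `(5,17)`** (`𝔽₃`): at every invertible `X₀` at most `6` of the 17
coefficient matrices are orthogonal to `X₀` (`2·5 + 1 + #{i : m_i ⊥ X₀} ≤ 17`). -/
theorem invLineCapPlus_xMarginal_225 (β : BilinComp (mulBilin (ZMod 3) 2 2 5) (Fin 17))
    (X₀ : Matrix (Fin 2) (Fin 2) (ZMod 3)) (hX₀ : X₀.det ≠ 0) :
    2 * 5 + 1 + (Finset.univ.filter fun i => dotX (mflat (xMarginal β i)) X₀ = 0).card ≤ 17 := by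
  have h1 := DeltaLaw.eleven_le_card_filter_ne_225 β (Fintype.card_fin 17) X₀ (isUnit_iff_ne_zero.mpr hX₀)
  change 11 ≤ (Finset.univ.filter fun i => ¬ β.f i X₀ = 0).card at h1
  have hsplit := Finset.card_filter_add_card_filter_not (s := (Finset.univ : Finset (Fin 17)))
    (fun i => β.f i X₀ = 0)
  rw [Finset.card_univ, Fintype.card_fin] at hsplit
  have hcongr : (Finset.univ.filter fun i => dotX (mflat (xMarginal β i)) X₀ = 0) =
      Finset.univ.filter fun i => β.f i X₀ = 0 := by
    refine Finset.filter_congr fun i _ => ?_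
    rw [f_apply_eq_dotX]
  rw [hcongr]
  omega

/-- **The `⟨2,2,5⟩@17` cell with the no-IP universe.** IF the census's list `Reps` of NO-IP representatives at `(5, 17)`
(engine-side: 1 537 orbits) is complete for the nowhere-zero marginals in `XCaps3 5 17` WITHOUT a saturated invertible point, AND
every one of them is excluded (engine-side, OPEN), THEN `18 ≤ R_𝔽₃(⟨2,2,5⟩)` (hence `= 18`). The restriction of the universe is
the kernel δ-law; NOT proved unconditionally here — the open rung `R_𝔽₃(⟨2,2,5⟩) ∈ {17, 18}` stands. -/
theorem eighteen_le_tensorRank_225_gf3_of_noIP_enumeration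
    (Reps : Set (Fin 17 → Matrix (Fin 2) (Fin 2) (ZMod 3)))
    (henum : ∀ m : Fin 17 → Matrix (Fin 2) (Fin 2) (ZMod 3), (∀ i, m i ≠ 0) → XCaps3 5 17 m →
      (∀ X₀ : Matrix (Fin 2) (Fin 2) (ZMod 3), X₀.det ≠ 0 →
        2 * 5 + 1 + (Finset.univ.filter fun i => dotX (mflat (m i)) X₀ = 0).card ≤ 17) →
      ∃ rep ∈ Reps, InOrbit m rep)
    (hexcl : ∀ rep ∈ Reps, ∀ β : BilinComp (mulBilin (ZMod 3) 2 2 5) (Fin 17), xMarginal β ≠ rep) :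
    18 ≤ tensorRank (matMulTensor (ZMod 3) 2 2 5) :=
  succ_le_tensorRank_22n_of_orbit_census 17 Reps
    (fun β => henum _ (xMarginal_ne_zero_of_le_tensorRank (tensorRank_matMulTensor_225_gf3_mem).1 β)
      (xCaps3_xMarginal β) (fun X₀ hX₀ => invLineCapPlus_xMarginal_225 β X₀ hX₀)) hexcl

/-- The same with the Hopcroft–Kerr ceiling: under the two engine-side hypotheses, `R_𝔽₃(⟨2,2,5⟩) = 18`. NOT proved here. -/
theorem tensorRank_225_gf3_eq_of_noIP_enumeration
    (Reps : Set (Fin 17 → Matrix (Fin 2) (Fin 2) (ZMod 3)))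
    (henum : ∀ m : Fin 17 → Matrix (Fin 2) (Fin 2) (ZMod 3), (∀ i, m i ≠ 0) → XCaps3 5 17 m →
      (∀ X₀ : Matrix (Fin 2) (Fin 2) (ZMod 3), X₀.det ≠ 0 →
        2 * 5 + 1 + (Finset.univ.filter fun i => dotX (mflat (m i)) X₀ = 0).card ≤ 17) →
      ∃ rep ∈ Reps, InOrbit m rep)
    (hexcl : ∀ rep ∈ Reps, ∀ β : BilinComp (mulBilin (ZMod 3) 2 2 5) (Fin 17), xMarginal β ≠ rep) :
    tensorRank (matMulTensor (ZMod 3) 2 2 5) = 18 := by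
  have h1 := eighteen_le_tensorRank_225_gf3_of_noIP_enumeration Reps henum hexcl
  have h2 := (tensorRank_matMulTensor_225_gf3_mem).2
  omega

end Summit.MatrixMultiplication.OmegaCensus.RankOnePlaneCapGeneral
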